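import Mathlib
import HarnessLib

/-!
# Monotonicity of the spectral radius: `|B| ≤ A ⇒ ρ(B) ≤ ρ(A)` (Horn–Johnson Thm. 8.1.18)

Topic `Literature/LinearAlgebra/Matrix`; support file (everything PROVED; no definitions; no named
facts). Companion of `CollatzWielandtUpperBound.lean` / `CollatzWielandtLowerBound.lean` (bounds
for `ρ(A)` from a test vector); here no test vector is needed.

Horn–Johnson, *Matrix Analysis* (2nd ed.), Thm. 8.1.18: for `A, B ∈ Mₙ` with `B ≥ 0` and
`|A| ≤ B` entrywise, `ρ(A) ≤ ρ(|A|) ≤ ρ(B)`; Cor. 8.1.19: `0 ≤ A ≤ B ⇒ ρ(A) ≤ ρ(B)`;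
Cor. 8.1.20(b): `maxᵢ aᵢᵢ ≤ ρ(A)` for `A ≥ 0`; Lemma 8.1.21: `ρ(A) ≤ maxᵢ Σⱼ aᵢⱼ` (the largest row
sum), with equality when all row sums are equal. (Wielandt's comparison theorem, weak form; the
strict / irreducible equality case, Berman–Plemmons Ch. 2 Thm. (2.14), needs Perron–Frobenius and
is not typed here.)

The book's proof of 8.1.18 IS the one typed here: `|Aᵐ| ≤ |A|ᵐ ≤ Bᵐ` entrywise ((8.1.10),
(8.1.12)), hence `‖Aᵐ‖ ≤ ‖Bᵐ‖` for an absolute (entrywise-monotone) matrix norm, and Gelfand's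
formula `ρ(X) = lim ‖Xᵐ‖^{1/m}` (Mathlib `spectrum.pow_nnnorm_pow_one_div_tendsto_nhds_spectralRadius`).
We use the `ℓ∞`-operator norm `‖M‖ = maxᵢ Σⱼ |mᵢⱼ|` on `Matrix n n ℂ` (`Matrix.linftyOpNormedAlgebra`,
a local instance) instead of the book's Frobenius norm. Statements are over `ℂ` (Gelfand's formula
needs a complex Banach algebra); a real nonnegative matrix `A` enters as `A.map (algebraMap ℝ ℂ)`,
and "dominated" means `‖bᵢⱼ‖ ≤ aᵢⱼ`:
* `norm_pow_apply_le_pow_apply` — `‖(Bᵐ)ᵢⱼ‖ ≤ (Aᵐ)ᵢⱼ` ((8.1.10) + (8.1.12));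
* `linfty_opNNNorm_pow_le_of_norm_le` — `‖Bᵐ‖ ≤ ‖Aᵐ‖` ((8.1.16) for this norm);
* `spectralRadius_le_of_norm_le` — Thm. 8.1.18: `ρ(B) ≤ ρ(A)` in the matrix algebra, and
  `spectralRadius_toLin'_le_of_norm_le` for `Matrix.toLin'`;
* `spectralRadius_le_of_nonneg_of_le` — Cor. 8.1.19 (`0 ≤ B ≤ A`, both real);
* `ofReal_diag_le_spectralRadius` — Cor. 8.1.20(b): `aᵢᵢ ≤ ρ(A)` for `A ≥ 0`;
* `spectralRadius_le_rowSum` — Lemma 8.1.21: `ρ(B) ≤ maxᵢ Σⱼ ‖bᵢⱼ‖` (any complex `B`), and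
  `rowSum_le_spectralRadius_of_rowSum_eq` — equal row sums `r` of `A ≥ 0` give `r ≤ ρ(A)` (so `=`).

References:
* R. A. Horn, C. R. Johnson, *Matrix Analysis*, 2nd ed., Cambridge University Press 2013, §8.1:
  (8.1.10), (8.1.12), (8.1.16), Thm. 8.1.18, Cor. 8.1.19, Cor. 8.1.20, Lemma 8.1.21 (Gelfand formula
  (5.6.14)). Held copy `book:horn2012-matrix-analysis`, PDF pp. 632–633. [HornJohnson2013]
* A. Berman, R. J. Plemmons, *Nonnegative Matrices in the Mathematical Sciences*, SIAM Classics 9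
  (1994), Ch. 2, Thm. (2.14) and Cor. (2.15) (Wielandt). [BermanPlemmons1994]
-/

namespace Literature.LinearAlgebra.Matrix

open scoped _root_.Matrix _root_.ENNReal _root_.NNReal _root_.Topology
open Finset _root_.Matrix Filter

variable {n : Type*} [Fintype n] [DecidableEq n]

/-- **(8.1.10) + (8.1.12), dominated form**: if `‖bᵢⱼ‖ ≤ aᵢⱼ` for all `i, j`, then
`‖(Bᵐ)ᵢⱼ‖ ≤ (Aᵐ)ᵢⱼ` for every `m` (in particular `Aᵐ ≥ 0`).
[cite: HornJohnson2013, (8.1.10) and (8.1.12)] -/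
theorem norm_pow_apply_le_pow_apply {B : Matrix n n ℂ} {A : Matrix n n ℝ}
    (hBA : ∀ i j, ‖B i j‖ ≤ A i j) (m : ℕ) (i j : n) : ‖(B ^ m) i j‖ ≤ (A ^ m) i j := by
  induction m generalizing i j with
  | zero =>
    rcases eq_or_ne i j with rfl | hij
    · simp
    · simp [Matrix.one_apply_ne hij]
  | succ m ih =>
    rw [pow_succ, pow_succ, Matrix.mul_apply, Matrix.mul_apply]
    calc ‖∑ l, (B ^ m) i l * B l j‖ ≤ ∑ l, ‖(B ^ m) i l * B l j‖ := norm_sum_le _ _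
      _ = ∑ l, ‖(B ^ m) i l‖ * ‖B l j‖ := sum_congr rfl fun l _ => norm_mul _ _
      _ ≤ ∑ l, (A ^ m) i l * A l j := sum_le_sum fun l _ =>
          mul_le_mul (ih i l) (hBA l j) (norm_nonneg _) ((norm_nonneg _).trans (ih i l))

section LinftyOp

attribute [local instance] Matrix.linftyOpNormedRing Matrix.linftyOpNormedAlgebra

/-- The `ℓ∞`-operator norm is entrywise monotone ((8.1.16) for `‖M‖ = maxᵢ Σⱼ |mᵢⱼ|`): if
`‖bᵢⱼ‖ ≤ ‖cᵢⱼ‖` for all `i, j` then `‖B‖ ≤ ‖C‖`. [cite: HornJohnson2013, (8.1.16)] -/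
theorem linfty_opNNNorm_le_of_norm_apply_le {B C : Matrix n n ℂ} (h : ∀ i j, ‖B i j‖ ≤ ‖C i j‖) :
    ‖B‖₊ ≤ ‖C‖₊ := by
  rw [Matrix.linfty_opNNNorm_def, Matrix.linfty_opNNNorm_def]
  exact Finset.sup_mono_fun fun i _ => sum_le_sum fun j _ =>
    NNReal.coe_le_coe.1 (by simpa only [coe_nnnorm] using h i j)

/-- `‖Bᵐ‖ ≤ ‖Aᵐ‖` (ℓ∞ operator norms, `A` read in `Mₙ(ℂ)`) whenever `‖bᵢⱼ‖ ≤ aᵢⱼ`.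
[cite: HornJohnson2013, Thm. 8.1.18 (proof)] -/
theorem linfty_opNNNorm_pow_le_of_norm_le {B : Matrix n n ℂ} {A : Matrix n n ℝ}
    (hBA : ∀ i j, ‖B i j‖ ≤ A i j) (m : ℕ) :
    ‖B ^ m‖₊ ≤ ‖(A.map (algebraMap ℝ ℂ)) ^ m‖₊ := by
  refine linfty_opNNNorm_le_of_norm_apply_le fun i j => ?_
  rw [← Matrix.map_pow, Matrix.map_apply, norm_algebraMap', Real.norm_eq_abs]
  exact (norm_pow_apply_le_pow_apply hBA m i j).trans (le_abs_self _)

/-- **Horn–Johnson Thm. 8.1.18 (Wielandt's comparison, weak form)**: if `‖bᵢⱼ‖ ≤ aᵢⱼ` for all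
`i, j` (so `A ≥ 0`), then `ρ(B) ≤ ρ(A)` — spectral radii over `ℂ` in the matrix algebra, `A` read as
`A.map (algebraMap ℝ ℂ)`. Proof: Gelfand's formula on both sides of `‖Bᵐ‖^{1/m} ≤ ‖Aᵐ‖^{1/m}`.
[cite: HornJohnson2013, Thm. 8.1.18] -/
theorem spectralRadius_le_of_norm_le {B : Matrix n n ℂ} {A : Matrix n n ℝ}
    (hBA : ∀ i j, ‖B i j‖ ≤ A i j) :
    spectralRadius ℂ B ≤ spectralRadius ℂ (A.map (algebraMap ℝ ℂ)) := by
  refine le_of_tendsto_of_tendsto' (spectrum.pow_nnnorm_pow_one_div_tendsto_nhds_spectralRadius B)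
    (spectrum.pow_nnnorm_pow_one_div_tendsto_nhds_spectralRadius (A.map (algebraMap ℝ ℂ)))
    fun m => ?_
  exact ENNReal.rpow_le_rpow (ENNReal.coe_le_coe.2 (linfty_opNNNorm_pow_le_of_norm_le hBA m))
    (by positivity)

/-- The middle term of Thm. 8.1.18: `ρ(B) ≤ ρ(|B|)` with `|B| = (‖bᵢⱼ‖)ᵢⱼ`.
[cite: HornJohnson2013, Thm. 8.1.18] -/
theorem spectralRadius_le_spectralRadius_abs (B : Matrix n n ℂ) :
    spectralRadius ℂ B ≤ spectralRadius ℂ ((B.map fun z => ‖z‖).map (algebraMap ℝ ℂ)) :=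
  spectralRadius_le_of_norm_le fun i j => by simp [Matrix.map_apply]

/-- **Cor. 8.1.19**: `0 ≤ B ≤ A` entrywise (real matrices) ⇒ `ρ(B) ≤ ρ(A)`.
[cite: HornJohnson2013, Cor. 8.1.19] -/
theorem spectralRadius_le_of_nonneg_of_le {B A : Matrix n n ℝ} (hB : ∀ i j, 0 ≤ B i j)
    (hBA : ∀ i j, B i j ≤ A i j) :
    spectralRadius ℂ (B.map (algebraMap ℝ ℂ)) ≤ spectralRadius ℂ (A.map (algebraMap ℝ ℂ)) :=
  spectralRadius_le_of_norm_le fun i j => by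
    rw [Matrix.map_apply, norm_algebraMap', Real.norm_of_nonneg (hB i j)]; exact hBA i j

/-- **Lemma 8.1.21 (largest row sum)**, for any complex matrix: `ρ(B) ≤ maxᵢ Σⱼ ‖bᵢⱼ‖`
(`= ‖B‖` in the ℓ∞ operator norm; `ρ ≤ ‖·‖` for any matrix norm, (5.6.9)).
[cite: HornJohnson2013, Lemma 8.1.21] -/
theorem spectralRadius_le_rowSum [Nonempty n] (B : Matrix n n ℂ) :
    spectralRadius ℂ B ≤ ((univ.sup fun i => ∑ j, ‖B i j‖₊ : ℝ≥0) : ℝ≥0∞) := by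
  rw [← Matrix.linfty_opNNNorm_def]
  exact spectrum.spectralRadius_le_nnnorm B

/-- The spectrum of `Matrix.toLin' B` is the spectrum of `B` in the matrix algebra
(`Matrix.toLinAlgEquiv'` is an algebra equivalence). [folklore] -/
private theorem spectrum_toLin'_eq' (B : Matrix n n ℂ) :
    spectrum ℂ (Matrix.toLin' B) = spectrum ℂ B :=
  AlgEquiv.spectrum_eq (Matrix.toLinAlgEquiv' : Matrix n n ℂ ≃ₐ[ℂ] _) B

/-- An eigen-equation witnesses a point of the spectrum: `B v = μ v`, `v ≠ 0` ⇒ `‖μ‖ ≤ ρ(B)`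
(matrix algebra over `ℂ`). [folklore] -/
private theorem nnnorm_le_spectralRadius_of_mulVec_eq {B : Matrix n n ℂ} {μ : ℂ} {v : n → ℂ}
    (hv : v ≠ 0) (h : B *ᵥ v = μ • v) : (‖μ‖₊ : ℝ≥0∞) ≤ spectralRadius ℂ B := by
  have hμ : Module.End.HasEigenvalue (Matrix.toLin' B) μ :=
    Module.End.hasEigenvalue_of_hasEigenvector
      (Module.End.hasEigenvector_iff.2
        ⟨Module.End.mem_eigenspace_iff.2 (by rw [Matrix.toLin'_apply, h]), hv⟩)
  have hmem : μ ∈ spectrum ℂ B := by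
    rw [← spectrum_toLin'_eq']; exact hμ.mem_spectrum
  exact le_iSup₂ (f := fun (k : ℂ) (_ : k ∈ spectrum ℂ B) => (‖k‖₊ : ℝ≥0∞)) μ hmem

/-- **`Matrix.toLin'` form of Thm. 8.1.18**: `‖bᵢⱼ‖ ≤ aᵢⱼ` ⇒
`spectralRadius ℂ (toLin' B) ≤ spectralRadius ℂ (toLin' (A.map (algebraMap ℝ ℂ)))`.
[cite: HornJohnson2013, Thm. 8.1.18] -/
theorem spectralRadius_toLin'_le_of_norm_le {B : Matrix n n ℂ} {A : Matrix n n ℝ}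
    (hBA : ∀ i j, ‖B i j‖ ≤ A i j) :
    spectralRadius ℂ (Matrix.toLin' B) ≤
      spectralRadius ℂ (Matrix.toLin' (A.map (algebraMap ℝ ℂ))) := by
  simp only [spectralRadius, spectrum_toLin'_eq']
  exact spectralRadius_le_of_norm_le hBA

/-- **Cor. 8.1.20(b)**: every diagonal entry of a nonnegative matrix is at most its spectral
radius, `aᵢᵢ ≤ ρ(A)` (Cor. 8.1.19 applied to `diag(a₁₁, …, aₙₙ) ≤ A`, whose spectral radius sees
the eigenpair `(aᵢᵢ, eᵢ)`). [cite: HornJohnson2013, Cor. 8.1.20] -/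
theorem ofReal_diag_le_spectralRadius {A : Matrix n n ℝ} (hA : ∀ i j, 0 ≤ A i j) (i : n) :
    ENNReal.ofReal (A i i) ≤ spectralRadius ℂ (A.map (algebraMap ℝ ℂ)) := by
  set D : Matrix n n ℝ := Matrix.diagonal fun j => A j j with hD
  have hD0 : ∀ k l, 0 ≤ D k l := fun k l => by
    rw [hD, Matrix.diagonal_apply]; split_ifs <;> simp [hA]
  have hDA : ∀ k l, D k l ≤ A k l := fun k l => by
    rw [hD, Matrix.diagonal_apply]; split_ifs with h
    · subst h; exact le_rfl
    · exact hA k l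
  have hmap : D.map (algebraMap ℝ ℂ) = Matrix.diagonal fun j => (algebraMap ℝ ℂ) (A j j) := by
    rw [hD, Matrix.diagonal_map (map_zero _)]
  -- the eigenpair (aᵢᵢ, eᵢ) of the complexified diagonal matrix
  have hv : (Pi.single i 1 : n → ℂ) ≠ 0 := by
    intro h0; simpa using congrFun h0 i
  have heig : (D.map (algebraMap ℝ ℂ)) *ᵥ (Pi.single i 1 : n → ℂ) =
      (algebraMap ℝ ℂ (A i i)) • (Pi.single i 1 : n → ℂ) := by
    rw [hmap, Matrix.diagonal_mulVec_single, mul_one]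
    ext k
    rcases eq_or_ne k i with rfl | hk
    · simp
    · simp [Pi.single_eq_of_ne hk]
  calc ENNReal.ofReal (A i i) = ((Real.toNNReal (A i i) : ℝ≥0) : ℝ≥0∞) := rfl
    _ ≤ (‖algebraMap ℝ ℂ (A i i)‖₊ : ℝ≥0∞) := by
        refine ENNReal.coe_le_coe.2 (Real.toNNReal_le_iff_le_coe.2 ?_)
        rw [coe_nnnorm, norm_algebraMap', Real.norm_of_nonneg (hA i i)]
    _ ≤ spectralRadius ℂ (D.map (algebraMap ℝ ℂ)) :=
        nnnorm_le_spectralRadius_of_mulVec_eq hv heig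
    _ ≤ spectralRadius ℂ (A.map (algebraMap ℝ ℂ)) := spectralRadius_le_of_nonneg_of_le hD0 hDA

/-- **Lemma 8.1.21, equal row sums**: if `A ≥ 0` and every row sum equals `r`, then `r ≤ ρ(A)`
(`𝟙` is an eigenvector for `r`); with `spectralRadius_le_rowSum` this gives `ρ(A) = r`.
[cite: HornJohnson2013, Lemma 8.1.21] -/
theorem ofReal_le_spectralRadius_of_rowSum_eq [Nonempty n] {A : Matrix n n ℝ} {r : ℝ}
    (hr : ∀ i, ∑ j, A i j = r) :
    ENNReal.ofReal r ≤ spectralRadius ℂ (A.map (algebraMap ℝ ℂ)) := by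
  rcases lt_or_ge r 0 with hneg | hr0
  · simp [ENNReal.ofReal_of_nonpos hneg.le]
  have hv : (fun _ : n => (1 : ℂ)) ≠ 0 := by
    intro h0; simpa using congrFun h0 (Classical.arbitrary n)
  have heig : (A.map (algebraMap ℝ ℂ)) *ᵥ (fun _ : n => (1 : ℂ)) =
      (algebraMap ℝ ℂ r) • (fun _ : n => (1 : ℂ)) := by
    ext i
    simp only [Matrix.mulVec, dotProduct, Matrix.map_apply, mul_one, Pi.smul_apply, smul_eq_mul]
    rw [← map_sum, hr i]
  calc ENNReal.ofReal r = ((Real.toNNReal r : ℝ≥0) : ℝ≥0∞) := rfl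
    _ ≤ (‖algebraMap ℝ ℂ r‖₊ : ℝ≥0∞) := by
        refine ENNReal.coe_le_coe.2 (Real.toNNReal_le_iff_le_coe.2 ?_)
        rw [coe_nnnorm, norm_algebraMap', Real.norm_of_nonneg hr0]
    _ ≤ spectralRadius ℂ (A.map (algebraMap ℝ ℂ)) := nnnorm_le_spectralRadius_of_mulVec_eq hv heig

/-- **Lemma 8.1.21 (equality)**: `A ≥ 0` with all row sums equal to `r` has `ρ(A) = r`.
[cite: HornJohnson2013, Lemma 8.1.21] -/
theorem spectralRadius_eq_of_rowSum_eq [Nonempty n] {A : Matrix n n ℝ} (hA : ∀ i j, 0 ≤ A i j)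
    {r : ℝ} (hr : ∀ i, ∑ j, A i j = r) :
    spectralRadius ℂ (A.map (algebraMap ℝ ℂ)) = ENNReal.ofReal r := by
  refine le_antisymm ?_ (ofReal_le_spectralRadius_of_rowSum_eq hr)
  have hr0 : 0 ≤ r := (hr (Classical.arbitrary n)) ▸ sum_nonneg fun j _ => hA _ j
  rw [show ENNReal.ofReal r = ((Real.toNNReal r : ℝ≥0) : ℝ≥0∞) from rfl]
  refine (spectralRadius_le_rowSum _).trans (ENNReal.coe_le_coe.2 (Finset.sup_le fun i _ => ?_))
  rw [← NNReal.coe_le_coe, NNReal.coe_sum, Real.coe_toNNReal r hr0, ← hr i]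
  refine le_of_eq (sum_congr rfl fun j _ => ?_)
  rw [coe_nnnorm, Matrix.map_apply, norm_algebraMap', Real.norm_of_nonneg (hA i j)]

end LinftyOp

end Literature.LinearAlgebra.Matrix
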